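import Literature.MathematicalPhysics.QuantumFieldTheory.Balaban1983to89.B11Eq103H1Complex

/-!
# `Balaban1983to89.B9Eq342GradientRowRepresentation` — T. Bałaban, *Propagators for lattice gauge theories in a background field*, Commun. Math. Phys.
# **99** (1985) 389–434 [Balaban1985BackgroundPropagators] Thm 3.1 (3.42) p. 397 (second entry, the covariant-gradient row), (3.23) p. 394, (3.3) pp. 390–391,
# (3.35) p. 396 (the small-field gauge on a cube), (3.43)∕(3.46) p. 398 (localisation by a cutoff): **THE REPRESENTATION STEP OF STOREY J IN THE CHAIN's
# CURRENCY — for a solution `u` of `(Δ_U + m)u = h`, a real cutoff `χ` and ANY comparison transporter data `U⁰`: the cut-off field `g = χu` solves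
# `(Δ_{U⁰} + m)g = χh + [Δ_U, χ]u + (Δ_{U⁰} − Δ_U)g` POINTWISE (the two brackets being exactly the left-hand sides of `B9Eq323KatoCutoffCommutator` §2∕§3
# and `B9Eq373KatoPairedRemainder`), hence `g = (Δ_{U⁰} + m)⁻¹(that right-hand side)` by the Green operator; at a bond where `χ ≡ 1` the covariant
# derivative of `u` IS that of `g`, and `∇_U g − ∇_{U⁰} g = t·(R_U − R_{U⁰})g(b₊)` — so `‖(∇_U u)(b₀)‖ ≤ ‖(∇_{U⁰}(Δ_{U⁰} + m)⁻¹k)(b₀)‖ + |t|·δ·‖u(b₀₊)‖`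
# for every function `k` that agrees with the right-hand side: the `hrep` binder of `B9Eq342GradientRowBootstrap.norm_le_of_gradient_response_bootstrap`
# in the response-map shape of `B9Eq342GradientRowPureGauge` §3∕§4, with the data `χh`, the perturbation `−[Δ_U, χ]u − (Δ_{U⁰} − Δ_U)g` and the ε₀ slot
# `|t|·δ·‖u(b₀₊)‖` DISPLAYED as letters**

statement-level skeleton of published theorems with citation tags; proofs where landed; nothing here is a claim about the Yang–Mills mass gap

CITATION HEADER (lean-in-tree rule).  Audit cell `pub-balaban`, sub-cell `t4`, BINDER row NE9; filed by NE9 crux-team LEAF PROVER 05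
(`b2b-balaban-t4-ne9-formalise-leaf-05`, gen 84).  SOURCE READ first-hand in the held text layer [Balaban1985BackgroundPropagators]
(`paper:balaban1985-cmp99-background-propagators`, journal page = PDF page + 388): p. 397 Thm 3.1 (3.42); p. 394 (3.23); pp. 390–391 (3.3); p. 396 (3.35) (the gauge in
which `|A| ≤ O(1)Mα₀(L^jη)^{-1}` on a cube); p. 398 (3.43)–(3.46) (localisation: print's random-walk expansion compares `G(U)` with the propagator of a simpler
background cube by cube).  The cell's storey J replaces print's random walk by a weighted sup-norm contraction (t4-ne9-idea-1 gens 111–145, N17 ∕ N22 ∕ P-J-2 ∕ P-J-3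
∕ N44–N46; this lineage gens 77–84: (GRB) `B9Eq342GradientRowBootstrap`, (CO) `B9Eq323KatoCutoffCommutator`, (PV) `B9Eq373KatoPairedRemainder`, (K34)
`B9Eq342GradientRowPureGauge`, (K38) `B9Eq342GradientRowNaturalPerturbation`); THIS file is the algebra of its REPRESENTATION step — [folklore] lattice algebra
and the triangle inequality; nothing printed is a hypothesis; the `[cite: …]` tags are TEXT LOCATIONS.

WHAT IS PROVED (sorry-free; 0 `def`; [folklore]).  `𝕜` is `RCLike`; transporter data `R S` (the background `U`) and `R⁰ S⁰` (the comparison `U⁰`) on the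
bonds of `TSite d Pd`; `t : ℝ` (= η⁻¹); `m : 𝕜`; `u h g : SiteL2K`; a real cutoff `χ` with `g(y) = χ(y)•u(y)` (`hg`, no `def`).
* §1 **`cutoff_comparison_identity`** — `(Δ_U + m)u = h` ⟹ at every site `x`:
  `((Δ_{U⁰} + m)g)(x) = χ(x)•h(x) + [(Δ_U g)(x) − χ(x)•(Δ_U u)(x)] + [(Δ_{U⁰} g)(x) − (Δ_U g)(x)]`.
* §2 **`equiv_covDerivL2K_cutoff`** — `(∇_U g)(y,ν) = χ(y+e_ν)•(∇_U u)(y,ν) + (t(χ(y+e_ν) − χ(y)))•u(y)`; **`norm_equiv_covDerivL2K_cutoff_le`** — hence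
  `‖(∇_U g)(y,ν)‖ ≤ |χ(y+e_ν)|·‖(∇_U u)(y,ν)‖ + |t(χ(y+e_ν) − χ(y))|·‖u(y)‖` (the first-order terms of (PV) at `g` against the bootstrap unknown `∇_U u`);
  **`equiv_covDerivL2K_cutoff_of_one`** — `χ(y) = χ(y+e_ν) = 1 ⟹ (∇_U g)(y,ν) = (∇_U u)(y,ν)`.
* §3 **`equiv_covDerivL2K_sub_background`** — `(∇_U f)(b) − (∇_{U⁰} f)(b) = t•(R(b) − R⁰(b))(f(b₊))`; **`norm_equiv_covDerivL2K_sub_background_le`** — with a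
  displayed fibre letter `‖R(b)w − R⁰(b)w‖ ≤ δ‖w‖`: `≤ |t|·δ·‖f(b₊)‖`.
* §4 **`eq_greenK_of_apply_eq`** — `T⁰ g = k̃ ⟹ g = (T⁰)⁻¹ k̃` for the Green operator `greenK T⁰ hpos` (`hpos` displayed: [B9] Thm 3.11's positivity, here of
  `Δ_{U⁰} + m`); **`norm_covDeriv_le_response_add`** — THE `hrep` SHAPE: `χ(b₀₋) = χ(b₀₊) = 1`, the δ-letter at `b₀`, and ANY `k : TSite → W` with
  `k(y) = ((Δ_{U⁰} + m)g)(y)` for all `y` ⟹ `‖(∇_U u)(b₀)‖ ≤ ‖(∇_{U⁰}((Δ_{U⁰} + m)⁻¹ k̃))(b₀)‖ + |t|·δ·‖u(b₀₊)‖` (`k̃` = `k` read in `SiteL2K`).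
* §5 slot conversions: **`norm_cutoff_data_le`** (`|χ| ≤ 1`, `‖h(y)‖ ≤ Γ·w(y)` ⟹ `‖χ(y)•h(y)‖ ≤ Γ·w(y)` — (GRB)'s `hg`); **`conversion_slot_le`**
  (`‖u(y)‖ ≤ N·w(y)`, `0 < β ≤ B`, `0 ≤ δ` ⟹ `|t|·δ·‖u(y)‖ ≤ (|t|·δ∕β)·N·(B·w(y))` — the `ε₀·N·w′` slot in (K34)'s currency `w′ b = B_{b.2}·W(b₊)`).
HONEST SCOPE.  Algebra of one step; the SIZES of the two brackets are (CO) §3 and (PV) (tree), the response letter is (K34), the perturbation letter (K38), the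
fibre letters `δ`, `b`, `b′` of the (3.35) gauge are `B9Eq387CubeReductionGaugeBackground` ∕ `B9Eq384RemainderLetters` ∕ (K30)–(K32) — NONE is applied here; which
resolvent of print (`G(U)`, `G′(U)` with the averaging penalty, or the local part `A₀` of [B11] (134)) is represented is the OWNER's assembly; nothing of Bałaban's
Thm 3.1 asserted, valued or discharged.  NOT summit progress (cell pub-balaban: NE9 NOT PRINTED ∕ NOT PROVED; «NE9 ⇐ the named binders»; row WALLED ON A MODEL
(O-NE9-1; #5 UNRULED); spine PROVED 0∕9; rung (B)+1 finite T⁴ — NOT infinite volume, NOT mass gap, NOT BetaPertH, NOT Clay).  HONEST DEPENDENCY (cell line):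
continuum YM on T⁴ ⇐ BetaPertH ∧ nine spine estimates (0/9 proved); BetaPertH ⇐ (D1) ∧ (D4) ∧ CAP+tail; G-an2-4 gates asym, D1 and NE2/3/4.  NEW file importing
`B11Eq103H1Complex` only; nothing modified.  Net new unproved facts: 0.
-/

noncomputable section

open scoped BigOperators InnerProductSpace

namespace Literature.MathematicalPhysics.QuantumFieldTheory.Balaban1983to89.B9Eq342GradientRowRepresentation

open B4Sect5Torus (TSite)
open B9SectCLatticeCarrier (Bond bpos btgt shift unshift)
open B9Eq33CovDerivVector (covDeriv covDeriv_apply_dir)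
open B9Eq311L2Pairing (WL2)
open B11Eq103H1Complex (SiteL2K covLaplaceSiteK covDerivL2K equiv_covDerivL2K greenK greenK_apply)

variable {𝕜 : Type*} [RCLike 𝕜] {d : ℕ} {Pd : Fin d → ℕ} {W : Type*} [NormedAddCommGroup W] [InnerProductSpace 𝕜 W]
  {c₀ : ℝ} [Fact (0 < c₀)]

/-! ## §1 The cut-off field against the comparison background: the identity -/

/-- **THE REPRESENTATION IDENTITY.**  If `(Δ_U + m)u = h` and `g = χu` pointwise, then for ANY second transporter data `(R⁰, S⁰)` and every site `x`:
`((Δ_{U⁰} + m)g)(x) = χ(x)•h(x) + [(Δ_U g)(x) − χ(x)•(Δ_U u)(x)] + [(Δ_{U⁰} g)(x) − (Δ_U g)(x)]` — the first bracket is the cutoff commutator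
(`B9Eq323KatoCutoffCommutator.equiv_covLaplaceSiteK_cutoff_sub`'s left-hand side at `f := u`), the second the two-background remainder
(`B9Eq373KatoPairedRemainder.equiv_covLaplaceSiteK_sub_eq_sum`'s at `f := g`, comparison background FIRST). [folklore]
[cite: Balaban1985BackgroundPropagators, (3.23) p.394, (3.43) p.398, (3.46) p.398] -/
theorem cutoff_comparison_identity (t : ℝ) (m : 𝕜) (R S R₀ S₀ : Bond d Pd → W →ₗ[𝕜] W) (u h g : SiteL2K 𝕜 d Pd c₀ W) (χ : TSite d Pd → ℝ)
    (hu : covLaplaceSiteK (t : 𝕜) R S u + m • u = h) (hg : ∀ y, WL2.equiv 𝕜 _ W g y = ((χ y : ℝ) : 𝕜) • WL2.equiv 𝕜 _ W u y) (x : TSite d Pd) :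
    WL2.equiv 𝕜 _ W (covLaplaceSiteK (t : 𝕜) R₀ S₀ g + m • g) x =
      ((χ x : ℝ) : 𝕜) • WL2.equiv 𝕜 _ W h x +
        (WL2.equiv 𝕜 _ W (covLaplaceSiteK (t : 𝕜) R S g) x - ((χ x : ℝ) : 𝕜) • WL2.equiv 𝕜 _ W (covLaplaceSiteK (t : 𝕜) R S u) x) +
        (WL2.equiv 𝕜 _ W (covLaplaceSiteK (t : 𝕜) R₀ S₀ g) x - WL2.equiv 𝕜 _ W (covLaplaceSiteK (t : 𝕜) R S g) x) := by
  have hh : WL2.equiv 𝕜 _ W h x = WL2.equiv 𝕜 _ W (covLaplaceSiteK (t : 𝕜) R S u) x + m • WL2.equiv 𝕜 _ W u x := by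
    rw [← hu, WL2.equiv_add, WL2.equiv_smul]; rfl
  rw [WL2.equiv_add, WL2.equiv_smul, Pi.add_apply, Pi.smul_apply, hh, hg x, smul_add, smul_comm m (((χ x : ℝ) : 𝕜)) (WL2.equiv 𝕜 _ W u x)]
  abel

/-! ## §2 The covariant derivative of a cut-off field -/

/-- **`∇_U(χu)` AGAINST `∇_U u`**: `(∇_U g)(y,ν) = χ(y+e_ν)•(∇_U u)(y,ν) + (t(χ(y+e_ν) − χ(y)))•u(y)` (from (3.3): `(∇_U f)(y,ν) = t•(R(y,ν)f(y+e_ν) − f(y))`,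
`R(y,ν)` linear). [folklore] [cite: Balaban1985BackgroundPropagators, (3.3) pp.390–391, (3.43) p.398] -/
theorem equiv_covDerivL2K_cutoff (t : ℝ) (R : Bond d Pd → W →ₗ[𝕜] W) (u g : SiteL2K 𝕜 d Pd c₀ W) (χ : TSite d Pd → ℝ)
    (hg : ∀ y, WL2.equiv 𝕜 _ W g y = ((χ y : ℝ) : 𝕜) • WL2.equiv 𝕜 _ W u y) (y : TSite d Pd) (ν : Fin d) :
    WL2.equiv 𝕜 _ W (covDerivL2K 𝕜 c₀ (t : 𝕜) R g) (y, ν) =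
      ((χ (shift ν y) : ℝ) : 𝕜) • WL2.equiv 𝕜 _ W (covDerivL2K 𝕜 c₀ (t : 𝕜) R u) (y, ν) +
        ((t * (χ (shift ν y) - χ y) : ℝ) : 𝕜) • WL2.equiv 𝕜 _ W u y := by
  rw [equiv_covDerivL2K, equiv_covDerivL2K, covDeriv_apply_dir, covDeriv_apply_dir, hg (shift ν y), hg y, map_smul]
  push_cast
  module

/-- **SIZE**: `‖(∇_U g)(y,ν)‖ ≤ |χ(y+e_ν)|·‖(∇_U u)(y,ν)‖ + |t(χ(y+e_ν) − χ(y))|·‖u(y)‖` — so the first-order terms of the two-background remainder at `g`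
(`B9Eq373KatoPairedRemainder.norm_equiv_covLaplaceSiteK_sub_le_paired`) are NATURAL in the bootstrap unknown `∇_U u` plus a value term, with the cutoff's
first difference quotient `≤ c∕r` as the extra coefficient. [folklore] [cite: Balaban1985BackgroundPropagators, (3.3) pp.390–391, (3.43) p.398] -/
theorem norm_equiv_covDerivL2K_cutoff_le (t : ℝ) (R : Bond d Pd → W →ₗ[𝕜] W) (u g : SiteL2K 𝕜 d Pd c₀ W) (χ : TSite d Pd → ℝ)
    (hg : ∀ y, WL2.equiv 𝕜 _ W g y = ((χ y : ℝ) : 𝕜) • WL2.equiv 𝕜 _ W u y) (y : TSite d Pd) (ν : Fin d) :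
    ‖WL2.equiv 𝕜 _ W (covDerivL2K 𝕜 c₀ (t : 𝕜) R g) (y, ν)‖ ≤
      |χ (shift ν y)| * ‖WL2.equiv 𝕜 _ W (covDerivL2K 𝕜 c₀ (t : 𝕜) R u) (y, ν)‖ + |t * (χ (shift ν y) - χ y)| * ‖WL2.equiv 𝕜 _ W u y‖ := by
  rw [equiv_covDerivL2K_cutoff t R u g χ hg y ν]
  refine (norm_add_le _ _).trans (add_le_add ?_ ?_) <;> rw [norm_smul, RCLike.norm_ofReal]

/-- **AT A BOND WHERE THE CUTOFF IS `1` AT BOTH ENDS** the covariant derivative of `u` IS that of `g`: `χ(y) = χ(y+e_ν) = 1 ⟹ (∇_U g)(y,ν) = (∇_U u)(y,ν)`.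
[folklore] [cite: Balaban1985BackgroundPropagators, (3.3) pp.390–391, (3.43) p.398] -/
theorem equiv_covDerivL2K_cutoff_of_one (t : ℝ) (R : Bond d Pd → W →ₗ[𝕜] W) (u g : SiteL2K 𝕜 d Pd c₀ W) (χ : TSite d Pd → ℝ)
    (hg : ∀ y, WL2.equiv 𝕜 _ W g y = ((χ y : ℝ) : 𝕜) • WL2.equiv 𝕜 _ W u y) (y : TSite d Pd) (ν : Fin d) (h0 : χ y = 1) (h1 : χ (shift ν y) = 1) :
    WL2.equiv 𝕜 _ W (covDerivL2K 𝕜 c₀ (t : 𝕜) R g) (y, ν) = WL2.equiv 𝕜 _ W (covDerivL2K 𝕜 c₀ (t : 𝕜) R u) (y, ν) := by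
  rw [equiv_covDerivL2K_cutoff t R u g χ hg y ν, h0, h1]
  simp

/-! ## §3 One covariant derivative, two backgrounds: the conversion at the output bond -/

/-- **`∇_U f − ∇_{U⁰} f` AT A BOND**: `(∇_U f)(b) − (∇_{U⁰} f)(b) = t•(R(b)(f(b₊)) − R⁰(b)(f(b₊)))` ((3.3); the value at `b₋` cancels). [folklore]
[cite: Balaban1985BackgroundPropagators, (3.3) pp.390–391, (3.73) p.405] -/
theorem equiv_covDerivL2K_sub_background (t : ℝ) (R R₀ : Bond d Pd → W →ₗ[𝕜] W) (f : SiteL2K 𝕜 d Pd c₀ W) (b : Bond d Pd) :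
    WL2.equiv 𝕜 _ W (covDerivL2K 𝕜 c₀ (t : 𝕜) R f) b - WL2.equiv 𝕜 _ W (covDerivL2K 𝕜 c₀ (t : 𝕜) R₀ f) b =
      (t : 𝕜) • (R b (WL2.equiv 𝕜 _ W f (btgt b)) - R₀ b (WL2.equiv 𝕜 _ W f (btgt b))) := by
  obtain ⟨y, ν⟩ := b
  rw [equiv_covDerivL2K, equiv_covDerivL2K, covDeriv_apply_dir, covDeriv_apply_dir, ← smul_sub]
  congr 1
  abel

/-- **SIZE** with a displayed fibre letter `‖R(b)w − R⁰(b)w‖ ≤ δ·‖w‖` (e.g. `B9Eq384RemainderLetters.norm_adTransportW_sub_le` ∕ (K32) §4 for the pair (gauge,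
pure gauge) of the (3.35) cube): `‖(∇_U f)(b) − (∇_{U⁰} f)(b)‖ ≤ |t|·δ·‖f(b₊)‖`. [folklore] [cite: Balaban1985BackgroundPropagators, (3.3) pp.390–391, (3.35) p.396] -/
theorem norm_equiv_covDerivL2K_sub_background_le (t : ℝ) (R R₀ : Bond d Pd → W →ₗ[𝕜] W) (f : SiteL2K 𝕜 d Pd c₀ W) (b : Bond d Pd) {δ : ℝ}
    (hδ : ∀ w, ‖R b w - R₀ b w‖ ≤ δ * ‖w‖) :
    ‖WL2.equiv 𝕜 _ W (covDerivL2K 𝕜 c₀ (t : 𝕜) R f) b - WL2.equiv 𝕜 _ W (covDerivL2K 𝕜 c₀ (t : 𝕜) R₀ f) b‖ ≤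
      |t| * δ * ‖WL2.equiv 𝕜 _ W f (btgt b)‖ := by
  rw [equiv_covDerivL2K_sub_background, norm_smul, RCLike.norm_ofReal, mul_assoc]
  exact mul_le_mul_of_nonneg_left (hδ _) (abs_nonneg t)

/-! ## §4 The Green operator of the comparison problem and the `hrep` shape -/

section Green

variable [FiniteDimensional 𝕜 W]

/-- `T⁰ g = k̃ ⟹ g = (T⁰)⁻¹ k̃` for the Green operator `greenK T⁰ hpos` of an operator with positive definite real part ([B9] Thm 3.11's positivity of
`Δ_{U⁰} + m`, DISPLAYED as `hpos`; `B11Eq103H1Complex.greenK_apply`). [folklore] [cite: Balaban1985BackgroundPropagators, Thm 3.11 p.416, (3.23) p.394] -/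
theorem eq_greenK_of_apply_eq (T : SiteL2K 𝕜 d Pd c₀ W →ₗ[𝕜] SiteL2K 𝕜 d Pd c₀ W)
    (hpos : ∀ v : SiteL2K 𝕜 d Pd c₀ W, v ≠ 0 → 0 < RCLike.re ⟪v, T v⟫_𝕜) {g k : SiteL2K 𝕜 d Pd c₀ W} (hk : T g = k) :
    g = greenK T hpos k := by
  rw [← hk, greenK_apply]

/-- **THE `hrep` SHAPE OF STOREY J.**  `(Δ_U + m)u = h` is NOT needed here — only: `g = χu` pointwise, `χ(b₀₋) = χ(b₀₊) = 1`, the fibre letter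
`‖R(b₀)w − R⁰(b₀)w‖ ≤ δ‖w‖`, the comparison operator `T⁰` (think `Δ_{U⁰} + m·1`) with `hpos`, and ANY plain function `k` agreeing with `T⁰g` pointwise (by §1:
`k = χh + [Δ_U,χ]u + (Δ_{U⁰} − Δ_U)g`).  Then
`‖(∇_U u)(b₀)‖ ≤ ‖(∇_{U⁰}((T⁰)⁻¹ k̃))(b₀)‖ + |t|·δ·‖u(b₀₊)‖`, `k̃ = (WL2.equiv).symm k` — the binder `hrep` of
`B9Eq342GradientRowBootstrap.norm_le_of_gradient_response_bootstrap` with `T b₀ k := (∇_{U⁰}((T⁰)⁻¹ k̃))(b₀)` (the response map of `B9Eq342GradientRowPureGauge`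
§2–§4 when `U⁰` is a pure gauge) and the ε₀ slot `|t|·δ·‖u(b₀₊)‖` (§5 converts it). [folklore]
[cite: Balaban1985BackgroundPropagators, Thm 3.1 (3.42) p.397, (3.43) p.398, (3.46) p.398, (3.35) p.396] -/
theorem norm_covDeriv_le_response_add (t : ℝ) (R R₀ : Bond d Pd → W →ₗ[𝕜] W) (T : SiteL2K 𝕜 d Pd c₀ W →ₗ[𝕜] SiteL2K 𝕜 d Pd c₀ W)
    (hpos : ∀ v : SiteL2K 𝕜 d Pd c₀ W, v ≠ 0 → 0 < RCLike.re ⟪v, T v⟫_𝕜) (u g : SiteL2K 𝕜 d Pd c₀ W) (χ : TSite d Pd → ℝ)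
    (hg : ∀ y, WL2.equiv 𝕜 _ W g y = ((χ y : ℝ) : 𝕜) • WL2.equiv 𝕜 _ W u y) (b₀ : Bond d Pd) (h0 : χ (bpos b₀) = 1) (h1 : χ (btgt b₀) = 1)
    {δ : ℝ} (hδ : ∀ w, ‖R b₀ w - R₀ b₀ w‖ ≤ δ * ‖w‖) (k : TSite d Pd → W) (hk : ∀ y, k y = WL2.equiv 𝕜 _ W (T g) y) :
    ‖WL2.equiv 𝕜 _ W (covDerivL2K 𝕜 c₀ (t : 𝕜) R u) b₀‖ ≤
      ‖WL2.equiv 𝕜 _ W (covDerivL2K 𝕜 c₀ (t : 𝕜) R₀ (greenK T hpos ((WL2.equiv 𝕜 (fun _ : TSite d Pd => c₀) W).symm k))) b₀‖ +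
        |t| * δ * ‖WL2.equiv 𝕜 _ W u (btgt b₀)‖ := by
  have hkg : greenK T hpos ((WL2.equiv 𝕜 (fun _ : TSite d Pd => c₀) W).symm k) = g := by
    have hk' : (WL2.equiv 𝕜 (fun _ : TSite d Pd => c₀) W).symm k = T g :=
      (WL2.equiv 𝕜 (fun _ : TSite d Pd => c₀) W).injective (by rw [Equiv.apply_symm_apply]; funext y; exact hk y)
    rw [hk', greenK_apply]
  have hDg : WL2.equiv 𝕜 _ W (covDerivL2K 𝕜 c₀ (t : 𝕜) R u) b₀ = WL2.equiv 𝕜 _ W (covDerivL2K 𝕜 c₀ (t : 𝕜) R g) b₀ := by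
    obtain ⟨y, ν⟩ := b₀
    exact (equiv_covDerivL2K_cutoff_of_one t R u g χ hg y ν h0 h1).symm
  have hub : ‖WL2.equiv 𝕜 _ W g (btgt b₀)‖ = ‖WL2.equiv 𝕜 _ W u (btgt b₀)‖ := by
    rw [hg (btgt b₀), h1]; simp
  rw [hkg, hDg, ← hub]
  calc ‖WL2.equiv 𝕜 _ W (covDerivL2K 𝕜 c₀ (t : 𝕜) R g) b₀‖
      = ‖WL2.equiv 𝕜 _ W (covDerivL2K 𝕜 c₀ (t : 𝕜) R₀ g) b₀ +
          (WL2.equiv 𝕜 _ W (covDerivL2K 𝕜 c₀ (t : 𝕜) R g) b₀ - WL2.equiv 𝕜 _ W (covDerivL2K 𝕜 c₀ (t : 𝕜) R₀ g) b₀)‖ := by rw [add_sub_cancel]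
    _ ≤ ‖WL2.equiv 𝕜 _ W (covDerivL2K 𝕜 c₀ (t : 𝕜) R₀ g) b₀‖ +
          ‖WL2.equiv 𝕜 _ W (covDerivL2K 𝕜 c₀ (t : 𝕜) R g) b₀ - WL2.equiv 𝕜 _ W (covDerivL2K 𝕜 c₀ (t : 𝕜) R₀ g) b₀‖ := norm_add_le _ _
    _ ≤ ‖WL2.equiv 𝕜 _ W (covDerivL2K 𝕜 c₀ (t : 𝕜) R₀ g) b₀‖ + |t| * δ * ‖WL2.equiv 𝕜 _ W g (btgt b₀)‖ :=
        add_le_add le_rfl (norm_equiv_covDerivL2K_sub_background_le t R R₀ g b₀ hδ)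

end Green

/-! ## §5 The two slot conversions (data `hg`, conversion `ε₀·N·w′`) -/

/-- **THE DATA SLOT**: `|χ(y)| ≤ 1` and `‖h(y)‖ ≤ Γ·w(y)` ⟹ `‖χ(y)•h(y)‖ ≤ Γ·w(y)` — (GRB)'s `hg` for the data `g_{b₀}(y) = χ_{b₀}(y)•h(y)`. [folklore]
[cite: Balaban1985BackgroundPropagators, Thm 3.1 (3.42) p.397, (3.43) p.398] -/
theorem norm_cutoff_data_le {X : Type*} (χ : X → ℝ) (hdat : X → W) (w : X → ℝ) {Γ : ℝ} (hχ : ∀ y, |χ y| ≤ 1)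
    (hh : ∀ y, ‖hdat y‖ ≤ Γ * w y) (y : X) : ‖((χ y : ℝ) : 𝕜) • hdat y‖ ≤ Γ * w y := by
  rw [norm_smul, RCLike.norm_ofReal]
  calc |χ y| * ‖hdat y‖ ≤ 1 * (Γ * w y) := mul_le_mul (hχ y) (hh y) (norm_nonneg _) zero_le_one
    _ = Γ * w y := one_mul _

omit [InnerProductSpace 𝕜 W] in
/-- **THE CONVERSION SLOT IN THE WEIGHTED CURRENCY**: a weighted value row `‖u(y)‖ ≤ N·w(y)`, `0 ≤ δ`, and a direction constant `B ≥ β > 0` ⟹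
`|t|·δ·‖u(y)‖ ≤ (|t|·δ∕β)·N·(B·w(y))` — the term `ε₀·N·w′ b₀` of (GRB)'s `hrep` for `w′ b = B_{b.2}·w(b₊)` ((K34)'s currency) with `ε₀ = |t|·δ∕β`.
[folklore] [cite: Balaban1985BackgroundPropagators, Thm 3.1 (3.42) p.397] -/
theorem conversion_slot_le {X : Type*} (u : X → W) (w : X → ℝ) {t δ N β B : ℝ} (hδ : 0 ≤ δ) (hβ : 0 < β) (hβB : β ≤ B)
    (hu : ∀ y, ‖u y‖ ≤ N * w y) (y : X) : |t| * δ * ‖u y‖ ≤ |t| * δ / β * N * (B * w y) := by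
  have htδ : 0 ≤ |t| * δ := mul_nonneg (abs_nonneg t) hδ
  have hN : 0 ≤ N * w y := (norm_nonneg _).trans (hu y)
  have h1 : |t| * δ * ‖u y‖ ≤ |t| * δ * (N * w y) := mul_le_mul_of_nonneg_left (hu y) htδ
  have h2 : |t| * δ * (N * w y) ≤ |t| * δ * (N * w y) * (B / β) :=
    le_mul_of_one_le_right (mul_nonneg htδ hN) ((one_le_div hβ).mpr hβB)
  calc |t| * δ * ‖u y‖ ≤ |t| * δ * (N * w y) * (B / β) := h1.trans h2
    _ = |t| * δ / β * N * (B * w y) := by field_simp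

end Literature.MathematicalPhysics.QuantumFieldTheory.Balaban1983to89.B9Eq342GradientRowRepresentation

end
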